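import Summits.BirchSwinnertonDyer.BirchSwinnertonDyer.Theorems.KimAtThreeFineKatoPerFactorDefinedTwist
import Literature.NumberTheory.AdelicBaseChange.PadicTensorCompletionGaloisProofs
import HarnessLib

/-!
# Item 20398 `FineKatoTwoExpDefectThree` (route W2 `KimAtThreeKolyvagin`, additive-defect `t = 0` rows): the per-factor
# package `hKlocᵃ` from a DEFINED `exp*` at ONE completion — `hKdefᵃ ⟹ hKlocᵃ`, i.e. w2-acc5 gen 5's
# `KimAtThreeFineKatoPerFactorSingle.perFactorKatoPackage_of_perFactorSingle` (crux 19560) with the two Kato-stratum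
# binders `¬ 3 ∣ c₃` / `¬ 3 ∣ c_P` DELETED (cell `bsd-addord`, seat w2-acc3 gen 9; helper, `--supports 20398`)

HONEST FRAMING.  TOOL theorem only (no definition, no named fact, no instance, no `sorry`); closes nothing; nothing is
booked; BSD is not proved by any of this.  `hKdefᵃ` is a DISPLAYED hypothesis.

WHY.  The additive-DEFECT rows (`3 ∣ c₃` or `3 ∣ c_P`; item 20398) are served by the SAME single-completion road as
crux 19560's Kato stratum (kim3 g14/g15: hKatoV2₀ ∧ hS5a ∧ hLog₀ → hKdef₀ → hKloc → rider), because on that road the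
stratum binders are used in exactly one place — Lemma L at `ℚ₃` — which this seat replaced by the two-exponent rider
(`KimAtThreeFineKatoTwoExpRiderAssembly`, `e = v₃(c₃)`).  This file is the `hKdef → hKloc` link of that road with
the binders deleted; statement and proof are otherwise w2-acc5's, token for token (credit: w2-acc5 gen 5; the
twist family `g`, the transports `S_w`, `exists_sub_eq_zsmul_apply_of_factorDef_conjMap`).  What `hKdefᵃ` displays,
per additive `t = 0` row at `v₀`: (a) R-κ; (b)(c) `hker`/`hdual` for `φ = exp*_ω` on `H¹(ℚ₃, T)`; per `(j, r)`, `Ψ`: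
ONE place `w₀ ∣ 3`, sets `Λ₀, M₀ ⊆ L_{w₀}` (log-lattice `⊆ 𝒪_{w₀}`, `∋ 0`, ONE unit-trace element; `exp*`-lattice with
`Tr(M₀·Λ₀) ⊆ ℤ₃`), the defined `exp*_{w₀}` as `φ₀` with (LAT₀), (RES₀), a twist family `g`, (DEF₀); (g) `ZetaBody`.

References: K. Kato, Astérisque 295 (2004) §9.4, Thm. 9.7 [Kato2004Asterisque]; J. W. S. Cassels, A. Fröhlich (1967)
Ch. II §10 (10.2), §11, Ch. VII §1.1 [CasselsFrohlichANT1967]; S. Bloch, K. Kato (1990) §3 Prop. 3.8, Ex. 3.11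
[BlochKato1990]; C.-H. Kim, AJM 148 (2026) §3.4.1 and the proof of Thm. 3.13 [Kim2022StructureSelmer]; J.-P. Serre,
*Local Fields* (1979) II §3 Prop. 4, VII §5 [SerreLocalFields1979]; kim3 memo KIM3-W2-C1c-SEMILOCAL-g14 §2/§8.
-/

noncomputable section

-- the cell's Theorems namespace `Summit.BirchSwinnertonDyer.BirchSwinnertonDyer.…` repeats the summit name by design (D-0017)
set_option linter.dupNamespace false

open scoped Classical NumberField TensorProduct ContRepresentation Pointwise
open Field NumberField IsDedekindDomain
open WeierstrassCurve Literature.NumberTheory.EllipticCurves Literature.NumberTheory.GaloisRepresentations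
  Literature.NumberTheory.GaloisRepresentations.DiscreteGaloisModule Literature.NumberTheory.GaloisCohomology
open Literature.NumberTheory.EllipticCurves.ModularForms Literature.NumberTheory.EllipticCurves.Rank1Residual
open Literature.NumberTheory.EllipticCurves.Kato2004 Literature.NumberTheory.EllipticCurves.Kato2004.EulerSystemValues
open Literature.NumberTheory.AdelicBaseChange Literature.NumberTheory.Automorphic
open Summit.BirchSwinnertonDyer.Rank1Residual.GaloisImage
open Summit.BirchSwinnertonDyer.Rank1Residual.Additive.LocalLog
open Summit.BirchSwinnertonDyer.BirchSwinnertonDyer.Theorems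
open Summit.BirchSwinnertonDyer.BirchSwinnertonDyer.Theorems.KimAtThreeFineKatoLevelCompat
open Summit.BirchSwinnertonDyer.BirchSwinnertonDyer.Theorems.KimAtThreeFineKatoPerFactorDefined
open Summit.BirchSwinnertonDyer.BirchSwinnertonDyer.Theorems.KimAtThreeFineKatoPerFactorDefinedTwist

namespace Summit.BirchSwinnertonDyer.BirchSwinnertonDyer.Theorems.KimAtThreeFineKatoTwoExpPerFactorSingle

set_option backward.isDefEq.respectTransparency false in
/-- **`hKlocᵃ ⟸ hKdefᵃ` — w2-acc5 gen 5's `perFactorKatoPackage_of_perFactorSingle` RE-RUN on EVERY additive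
`t = 0` row**: the hypothesis `hKdefᵃ` and the conclusion `hKlocᵃ` are w2-acc5's `hKdef₀` / `hKloc` VERBATIM with the
two Kato-stratum binder lines `¬ 3 ∣ c₃ →`, `¬ 3 ∣ c_P →` deleted (they are pass-through in the original proof,
which is reproduced unchanged: per factor `w`, the twisted COMPAT at `w₀` for `σ := g_w`
(`exists_sub_eq_zsmul_apply_of_factorDef_conjMap`), transported along `S_w = (g̃_w⁻¹)_*` — `ℚ_v`-linear,
integer- and trace-preserving; the lattices are `S_w(Λ₀)`, `S_w(M₀)`, the unit-trace element `S_{w₀}(ℓ₀)`).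
`hKdefᵃ` displayed; closes nothing; the consumer is this seat's `KimAtThreeFineKatoTwoExpOfPerFactor`.
[cite: Kato2004Asterisque, §9.4 and Thm. 9.7 (pp. 188–189)]
[cite: Kim2022StructureSelmer, §3.4.1 and the proof of Thm. 3.13 (arXiv v3 pp. 26–27)]
[cite: CasselsFrohlichANT1967, Ch. II §10 Theorem (10.2) and Ch. VII §1.1] -/
theorem perFactorKatoPackage_of_perFactorSingle
    (hKdef₀ : ∀ (W : WeierstrassCurve ℚ) [W.IsElliptic] [W.IsGloballyMinimal]
      [ContinuousSMul ℤ_[3] (W.tateModule 3)] [Module.Free ℤ_[3] (W.tateModule 3)]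
      [Module.Finite ℤ_[3] (W.tateModule 3)],
      (∀ m : ℕ, W.HasSurjectiveModNGaloisRep (3 ^ m : ℕ)) →
      (haveI : Fact (Nat.Prime 3) := ⟨Nat.prime_three⟩; Addv W 3) →
      Nat.card {Q : (W.baseChange ℚ_[3]).toAffine.Point // (3 : ℕ) • Q = 0} = 1 →
      ∀ {N : ℕ} [NeZero N] (P : ModularParametrizationData W N), N = W.conductorNorm ℤ →
        (∀ z ∈ P.L.lattice, ∃ w ∈ periodLattice P.f, z = P.c * w) →
        ∃ (ι : (n : ℕ) → (CyclotomicField n ℚ →+* ℂ)) (κK : ℝ)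
          (Λ : ∀ (k' : ℕ) (r : Finset (HeightOneSpectrum (𝓞 ℚ))),
            H1 (tateRep W 3) (cycSubgroup 3 k' r) →ₗ[ℤ_[3]]
              ℚ_[3] ⊗[ℚ] CyclotomicField (cycLevel 3 k' r) ℚ)
          (φ : (tateLocalRep W 3 (Sum.inr ((Rat.HeightOneSpectrum.primesEquiv (R := 𝓞 ℚ)).symm ⟨3, Fact.out⟩))).cohomology 1 →+ ℚ_[3]),
          κK ≠ 0 ∧ (∃ u : ℚ, (u : ℝ) = κK ∧ padicValRat 3 u = 0) ∧
          (∀ y, φ y = 0 ↔ ∀ j : ℕ, tateLocalMap W 3 j (Sum.inr ((Rat.HeightOneSpectrum.primesEquiv (R := 𝓞 ℚ)).symm ⟨3, Fact.out⟩)) y ∈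
            W.kummerSelmerStructure (((3 : ℕ) : ℤ) ^ j * ((3 : ℕ) : ℤ)) (Sum.inr ((Rat.HeightOneSpectrum.primesEquiv (R := 𝓞 ℚ)).symm ⟨3, Fact.out⟩))) ∧
          (∀ a : ℚ_[3], (∃ y, φ y = a) ↔
            ∀ Q : (W.baseChange ℚ_[3]).toAffine.Point, ‖a * padicLog (W.baseChange ℚ_[3]) Q‖ ≤ 1) ∧
          (∀ (j : ℕ) (r : Finset (HeightOneSpectrum (𝓞 ℚ)))
            (Ψ : ℚ_[3] ⊗[ℚ] CyclotomicField (cycLevel 3 0 r) ℚ ≃ₐ[ℚ]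
              (Π w : ((Rat.HeightOneSpectrum.primesEquiv (R := 𝓞 ℚ)).symm ⟨3, Fact.out⟩).Extension
                (𝓞 (CyclotomicField (cycLevel 3 0 r) ℚ)), w.1.adicCompletion (CyclotomicField (cycLevel 3 0 r) ℚ))),
            (∀ (s : ℚ_[3]) (x : CyclotomicField (cycLevel 3 0 r) ℚ)
              (w : ((Rat.HeightOneSpectrum.primesEquiv (R := 𝓞 ℚ)).symm ⟨3, Fact.out⟩).Extension
                (𝓞 (CyclotomicField (cycLevel 3 0 r) ℚ))),
              Ψ (s ⊗ₜ[ℚ] x) w =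
                algebraMap (CyclotomicField (cycLevel 3 0 r) ℚ) (w.1.adicCompletion (CyclotomicField (cycLevel 3 0 r) ℚ)) x *
                algebraMap (((Rat.HeightOneSpectrum.primesEquiv (R := 𝓞 ℚ)).symm ⟨3, Fact.out⟩).adicCompletion ℚ)
                  (w.1.adicCompletion (CyclotomicField (cycLevel 3 0 r) ℚ)) (Padic.adicCompletionEquiv (𝓞 ℚ) ⟨3, Fact.out⟩ s)) →
            ∃ (w₀ : ((Rat.HeightOneSpectrum.primesEquiv (R := 𝓞 ℚ)).symm ⟨3, Fact.out⟩).Extension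
                (𝓞 (CyclotomicField (cycLevel 3 0 r) ℚ)))
              (Λ₀ M₀ : Set (w₀.1.adicCompletion (CyclotomicField (cycLevel 3 0 r) ℚ)))
              (φ₀ : ((tateLocalRep W 3 (Sum.inr ((Rat.HeightOneSpectrum.primesEquiv (R := 𝓞 ℚ)).symm ⟨3, Fact.out⟩))).restrict
                  (absGaloisRestrict (((Rat.HeightOneSpectrum.primesEquiv (R := 𝓞 ℚ)).symm ⟨3, Fact.out⟩).adicCompletion ℚ)
                    (w₀.1.adicCompletion (CyclotomicField (cycLevel 3 0 r) ℚ)))).cohomology 1 →+ (w₀.1.adicCompletion (CyclotomicField (cycLevel 3 0 r) ℚ)))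
              (g : ((Rat.HeightOneSpectrum.primesEquiv (R := 𝓞 ℚ)).symm ⟨3, Fact.out⟩).Extension
                (𝓞 (CyclotomicField (cycLevel 3 0 r) ℚ)) → absoluteGaloisGroup ℚ)
              (hg : ∀ w : ((Rat.HeightOneSpectrum.primesEquiv (R := 𝓞 ℚ)).symm ⟨3, Fact.out⟩).Extension
                (𝓞 (CyclotomicField (cycLevel 3 0 r) ℚ)),
                sigma (cycLevel 3 0 r) (modNCyclotomicCharacter ℚ (cycLevel 3 0 r) (g w)) • w.1 = w₀.1),
              Λ₀ ⊆ w₀.1.adicCompletionIntegers (CyclotomicField (cycLevel 3 0 r) ℚ) ∧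
              (0 : (w₀.1.adicCompletion (CyclotomicField (cycLevel 3 0 r) ℚ))) ∈ Λ₀ ∧
              (∃ ℓ₀ ∈ Λ₀, ‖(Padic.adicCompletionEquiv (𝓞 ℚ) ⟨3, Fact.out⟩).symm
                (Algebra.trace (((Rat.HeightOneSpectrum.primesEquiv (R := 𝓞 ℚ)).symm ⟨3, Fact.out⟩).adicCompletion ℚ) (w₀.1.adicCompletion (CyclotomicField (cycLevel 3 0 r) ℚ)) ℓ₀)‖ = 1) ∧
              (∀ μ ∈ M₀, ∀ ℓ ∈ Λ₀, ‖(Padic.adicCompletionEquiv (𝓞 ℚ) ⟨3, Fact.out⟩).symm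
                (Algebra.trace (((Rat.HeightOneSpectrum.primesEquiv (R := 𝓞 ℚ)).symm ⟨3, Fact.out⟩).adicCompletion ℚ) (w₀.1.adicCompletion (CyclotomicField (cycLevel 3 0 r) ℚ)) (μ * ℓ))‖ ≤ 1) ∧
              (∀ z, φ₀ z ∈ M₀) ∧
              (∀ h : (tateLocalRep W 3 (Sum.inr ((Rat.HeightOneSpectrum.primesEquiv (R := 𝓞 ℚ)).symm ⟨3, Fact.out⟩))).cohomology 1,
                φ₀ (ContinuousRep.cohomologyRes (tateLocalRep W 3 (Sum.inr ((Rat.HeightOneSpectrum.primesEquiv (R := 𝓞 ℚ)).symm ⟨3, Fact.out⟩)))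
                    (absGaloisRestrict (((Rat.HeightOneSpectrum.primesEquiv (R := 𝓞 ℚ)).symm ⟨3, Fact.out⟩).adicCompletion ℚ) (w₀.1.adicCompletion (CyclotomicField (cycLevel 3 0 r) ℚ))) 1 h) =
                  algebraMap (((Rat.HeightOneSpectrum.primesEquiv (R := 𝓞 ℚ)).symm ⟨3, Fact.out⟩).adicCompletion ℚ) (w₀.1.adicCompletion (CyclotomicField (cycLevel 3 0 r) ℚ)) (Padic.adicCompletionEquiv (𝓞 ℚ) ⟨3, Fact.out⟩ (φ h))) ∧
              (∀ (w : ((Rat.HeightOneSpectrum.primesEquiv (R := 𝓞 ℚ)).symm ⟨3, Fact.out⟩).Extension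
                (𝓞 (CyclotomicField (cycLevel 3 0 r) ℚ)))
                (y : H1 (tateRep W 3) (cycSubgroup 3 0 r))
                (φ'' : contOneCocycles (subgroupRep (tateRep W 3).toTopRep (cycSubgroup 3 0 r)))
                (ψT : contOneCocycles ((tateLocalRep W 3 (Sum.inr ((Rat.HeightOneSpectrum.primesEquiv (R := 𝓞 ℚ)).symm ⟨3, Fact.out⟩))).restrict
                    (absGaloisRestrict (((Rat.HeightOneSpectrum.primesEquiv (R := 𝓞 ℚ)).symm ⟨3, Fact.out⟩).adicCompletion ℚ) (w₀.1.adicCompletion (CyclotomicField (cycLevel 3 0 r) ℚ)))).toTopRep),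
                  oneCocycleClass _ φ'' = conjMap (tateRep W 3).toTopRep (cycSubgroup 3 0 r) (g w) 1 y →
                  (∀ σ, ψT.1 σ = φ''.1 ⟨absGaloisRestrictTower ℚ (((Rat.HeightOneSpectrum.primesEquiv (R := 𝓞 ℚ)).symm ⟨3, Fact.out⟩).adicCompletion ℚ) (w₀.1.adicCompletion (CyclotomicField (cycLevel 3 0 r) ℚ)) σ,
                    absGaloisRestrictTower_adicCompletion_mem_cycSubgroup r w₀ σ⟩) →
                  Ψ (Λ 0 r y) w = galAdicCompletionMap
                    (sigma (cycLevel 3 0 r) (modNCyclotomicCharacter ℚ (cycLevel 3 0 r) (g w)))⁻¹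
                    (inv_smul_eq_of_smul_eq (hg w)) (φ₀ (oneCocycleClass _ ψT)))) ∧
          ∀ (c d a : ℤ) (A : ℕ), 0 < A → Int.gcd c (6 * 3 * A) = 1 → Int.gcd d (6 * 3 * N) = 1 →
            ∃ (z : ∀ (k' : ℕ) (r : (cyclotomicLevelsRat 3 (badPlaces c d A N)).Ideals),
                  H1 (tateRep W 3) ((cyclotomicLevelsRat 3 (badPlaces c d A N)).level k' r.1))
              (x : ∀ (k' : ℕ) (r : (cyclotomicLevelsRat 3 (badPlaces c d A N)).Ideals),
                  CyclotomicField (cycLevel 3 k' r.1) ℚ),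
              ZetaBody W 3 P.f ι κK Λ c d a A z x) :
    ∀ (W : WeierstrassCurve ℚ) [W.IsElliptic] [W.IsGloballyMinimal]
      [ContinuousSMul ℤ_[3] (W.tateModule 3)] [Module.Free ℤ_[3] (W.tateModule 3)]
      [Module.Finite ℤ_[3] (W.tateModule 3)],
      (∀ m : ℕ, W.HasSurjectiveModNGaloisRep (3 ^ m : ℕ)) →
      (haveI : Fact (Nat.Prime 3) := ⟨Nat.prime_three⟩; Addv W 3) →
      Nat.card {Q : (W.baseChange ℚ_[3]).toAffine.Point // (3 : ℕ) • Q = 0} = 1 →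
      ∀ (v₃ : HeightOneSpectrum (𝓞 ℚ)), ((3 : ℕ) : 𝓞 ℚ) ∈ v₃.asIdeal →
      ∀ {N : ℕ} [NeZero N] (P : ModularParametrizationData W N), N = W.conductorNorm ℤ →
        (∀ z ∈ P.L.lattice, ∃ w ∈ periodLattice P.f, z = P.c * w) →
        ∃ (ι : (n : ℕ) → (CyclotomicField n ℚ →+* ℂ)) (κK : ℝ)
          (Λ : ∀ (k' : ℕ) (r : Finset (HeightOneSpectrum (𝓞 ℚ))),
            H1 (tateRep W 3) (cycSubgroup 3 k' r) →ₗ[ℤ_[3]]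
              ℚ_[3] ⊗[ℚ] CyclotomicField (cycLevel 3 k' r) ℚ)
          (φ : (tateLocalRep W 3 (Sum.inr v₃)).cohomology 1 →+ ℚ_[3]),
          κK ≠ 0 ∧ (∃ u : ℚ, (u : ℝ) = κK ∧ padicValRat 3 u = 0) ∧
          (∀ y, φ y = 0 ↔ ∀ j : ℕ, tateLocalMap W 3 j (Sum.inr v₃) y ∈
            W.kummerSelmerStructure (((3 : ℕ) : ℤ) ^ j * ((3 : ℕ) : ℤ)) (Sum.inr v₃)) ∧
          (∀ a : ℚ_[3], (∃ y, φ y = a) ↔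
            ∀ Q : (W.baseChange ℚ_[3]).toAffine.Point, ‖a * padicLog (W.baseChange ℚ_[3]) Q‖ ≤ 1) ∧
          (∀ (j : ℕ) (r : Finset (HeightOneSpectrum (𝓞 ℚ)))
            (Ψ : ℚ_[3] ⊗[ℚ] CyclotomicField (cycLevel 3 0 r) ℚ ≃ₐ[ℚ]
              (Π w : ((Rat.HeightOneSpectrum.primesEquiv (R := 𝓞 ℚ)).symm ⟨3, Fact.out⟩).Extension
                (𝓞 (CyclotomicField (cycLevel 3 0 r) ℚ)), w.1.adicCompletion (CyclotomicField (cycLevel 3 0 r) ℚ))),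
            (∀ (s : ℚ_[3]) (x : CyclotomicField (cycLevel 3 0 r) ℚ)
              (w : ((Rat.HeightOneSpectrum.primesEquiv (R := 𝓞 ℚ)).symm ⟨3, Fact.out⟩).Extension
                (𝓞 (CyclotomicField (cycLevel 3 0 r) ℚ))),
              Ψ (s ⊗ₜ[ℚ] x) w =
                algebraMap (CyclotomicField (cycLevel 3 0 r) ℚ) (w.1.adicCompletion (CyclotomicField (cycLevel 3 0 r) ℚ)) x *
                algebraMap (((Rat.HeightOneSpectrum.primesEquiv (R := 𝓞 ℚ)).symm ⟨3, Fact.out⟩).adicCompletion ℚ)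
                  (w.1.adicCompletion (CyclotomicField (cycLevel 3 0 r) ℚ)) (Padic.adicCompletionEquiv (𝓞 ℚ) ⟨3, Fact.out⟩ s)) →
            ∃ (Λ₀' M' : ∀ w : ((Rat.HeightOneSpectrum.primesEquiv (R := 𝓞 ℚ)).symm ⟨3, Fact.out⟩).Extension
                (𝓞 (CyclotomicField (cycLevel 3 0 r) ℚ)), Set (w.1.adicCompletion (CyclotomicField (cycLevel 3 0 r) ℚ))),
              (∀ w, Λ₀' w ⊆ w.1.adicCompletionIntegers (CyclotomicField (cycLevel 3 0 r) ℚ)) ∧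
              (∀ w, (0 : w.1.adicCompletion (CyclotomicField (cycLevel 3 0 r) ℚ)) ∈ Λ₀' w) ∧
              (∃ w₀, ∃ ℓ₀ ∈ Λ₀' w₀, ‖(Padic.adicCompletionEquiv (𝓞 ℚ) ⟨3, Fact.out⟩).symm
                (Algebra.trace (((Rat.HeightOneSpectrum.primesEquiv (R := 𝓞 ℚ)).symm ⟨3, Fact.out⟩).adicCompletion ℚ)
                  (w₀.1.adicCompletion (CyclotomicField (cycLevel 3 0 r) ℚ)) ℓ₀)‖ = 1) ∧
              (∀ w, ∀ μ ∈ M' w, ∀ ℓ ∈ Λ₀' w, ‖(Padic.adicCompletionEquiv (𝓞 ℚ) ⟨3, Fact.out⟩).symm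
                (Algebra.trace (((Rat.HeightOneSpectrum.primesEquiv (R := 𝓞 ℚ)).symm ⟨3, Fact.out⟩).adicCompletion ℚ)
                  (w.1.adicCompletion (CyclotomicField (cycLevel 3 0 r) ℚ)) (μ * ℓ))‖ ≤ 1) ∧
              ∀ (Ψ' : H1 (tateRep W 3) (cycSubgroup 3 0 r) →+
                  continuousCohomology 1 (subgroupRep
                    (W.torsionGaloisModule (((3 : ℕ) : ℤ) ^ j * ((3 : ℕ) : ℤ))).toTopRep (cycSubgroup 3 0 r))),
                (∀ (φ' : contOneCocycles (subgroupRep (tateRep W 3).toTopRep (cycSubgroup 3 0 r)))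
                    (ψ : contOneCocycles (subgroupRep
                      (W.torsionGaloisModule (((3 : ℕ) : ℤ) ^ j * ((3 : ℕ) : ℤ))).toTopRep (cycSubgroup 3 0 r))),
                    (∀ g, ((ψ.1 g : geomTorsion W (((3 : ℕ) : ℤ) ^ j * ((3 : ℕ) : ℤ))) : geomPoints W) =
                      TateModule.proj 3 (j + 1) (φ'.1 g)) →
                    Ψ' (oneCocycleClass _ φ') = oneCocycleClass _ ψ) →
                ∀ (y : H1 (tateRep W 3) (cycSubgroup 3 0 r))
                  (κ₀ : galoisCohomology (W.torsionGaloisModule (((3 : ℕ) : ℤ) ^ j * ((3 : ℕ) : ℤ))) 1)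
                  (h : (tateLocalRep W 3 (Sum.inr v₃)).cohomology 1),
                  resSubgroup (W.torsionGaloisModule (((3 : ℕ) : ℤ) ^ j * ((3 : ℕ) : ℤ))).toTopRep
                      (cycSubgroup 3 0 r) 1 κ₀ = Ψ' y →
                  galoisCohomology.localization (W.torsionGaloisModule (((3 : ℕ) : ℤ) ^ j * ((3 : ℕ) : ℤ)))
                      (Sum.inr v₃) 1 κ₀ = tateLocalMap W 3 j (Sum.inr v₃) h →
                  ∀ w, ∃ μ ∈ M' w,
                    Ψ ((φ h ⊗ₜ[ℚ] (1 : CyclotomicField (cycLevel 3 0 r) ℚ)) -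
                        (((3 : ℕ) : ℤ_[3]) ^ (0 : ℕ)) • Λ 0 r y) w =
                      (((3 : ℕ) : w.1.adicCompletion (CyclotomicField (cycLevel 3 0 r) ℚ)) ^ (j + 1)) * μ) ∧
          ∀ (c d a : ℤ) (A : ℕ), 0 < A → Int.gcd c (6 * 3 * A) = 1 → Int.gcd d (6 * 3 * N) = 1 →
            ∃ (z : ∀ (k' : ℕ) (r : (cyclotomicLevelsRat 3 (badPlaces c d A N)).Ideals),
                  H1 (tateRep W 3) ((cyclotomicLevelsRat 3 (badPlaces c d A N)).level k' r.1))
              (x : ∀ (k' : ℕ) (r : (cyclotomicLevelsRat 3 (badPlaces c d A N)).Ideals),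
                  CyclotomicField (cycLevel 3 k' r.1) ℚ),
              ZetaBody W 3 P.f ι κK Λ c d a A z x := by
  intro W _ _ _ _ _ htow hadd ht v₃ hv₃ N _ P hN hlat
  -- the row's place IS the base place of `Ψ`
  have hv₃eq : v₃ = ((Rat.HeightOneSpectrum.primesEquiv (R := 𝓞 ℚ)).symm ⟨3, Fact.out⟩) := by
    have h3 := primesEquiv_eq_of_natCast_mem Nat.prime_three hv₃
    have h3' : Rat.HeightOneSpectrum.primesEquiv (R := 𝓞 ℚ) v₃ = ⟨3, Fact.out⟩ := Subtype.ext h3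
    rw [← h3', Equiv.symm_apply_apply]
  subst hv₃eq
  obtain ⟨ι, κK, Λ, φ, hκ0, hκu, hker, hdual, hloc, hz⟩ := hKdef₀ W htow hadd ht P hN hlat
  refine ⟨ι, κK, Λ, φ, hκ0, hκu, hker, hdual, fun j r Ψ hΨ => ?_, hz⟩
  obtain ⟨w₀, Λ₀, M₀, φ₀, g, hg, hΛ₀, h0, ⟨ℓ₀, hℓ₀, hunit⟩, hM₀, hlat₀, hres₀, hdef₀⟩ := hloc j r Ψ hΨ
  -- the transports `S_w = (g̃_w⁻¹)_* : L_{w₀} → L_w`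
  let S : ∀ w : ((Rat.HeightOneSpectrum.primesEquiv (R := 𝓞 ℚ)).symm ⟨3, Fact.out⟩).Extension
      (𝓞 (CyclotomicField (cycLevel 3 0 r) ℚ)),
      w₀.1.adicCompletion (CyclotomicField (cycLevel 3 0 r) ℚ) →+*
        w.1.adicCompletion (CyclotomicField (cycLevel 3 0 r) ℚ) := fun w =>
    galAdicCompletionMap (sigma (cycLevel 3 0 r) (modNCyclotomicCharacter ℚ (cycLevel 3 0 r) (g w)))⁻¹
      (inv_smul_eq_of_smul_eq (hg w))
  have hS : ∀ w x, S w x = galAdicCompletionMap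
      (sigma (cycLevel 3 0 r) (modNCyclotomicCharacter ℚ (cycLevel 3 0 r) (g w)))⁻¹
      (inv_smul_eq_of_smul_eq (hg w)) x := fun _ _ => rfl
  refine ⟨fun w => S w '' Λ₀, fun w => S w '' M₀, ?_, ?_, ?_, ?_, ?_⟩
  · -- integrality is transported (`σ 𝒪_{w₀} = 𝒪_w`)
    rintro w _ ⟨ℓ, hℓ, rfl⟩
    exact (galAdicCompletionMap_mem_adicCompletionIntegers_iff _ _ _ ℓ).mpr (hΛ₀ hℓ)
  · intro w
    exact ⟨0, h0, map_zero _⟩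
  · -- the unit-trace element, transported within `L_{w₀}`
    refine ⟨w₀, S w₀ ℓ₀, ⟨ℓ₀, hℓ₀, rfl⟩, ?_⟩
    rw [hS, trace_galAdicCompletionMap]
    exact hunit
  · -- the trace pairing is transported
    rintro w _ ⟨μ, hμ, rfl⟩ _ ⟨ℓ, hℓ, rfl⟩
    rw [← map_mul, hS, trace_galAdicCompletionMap]
    exact hM₀ μ hμ ℓ hℓ
  intro Ψ' hΨ' y κ₀ h hres hlocκ w
  -- `Place.Completion (Sum.inr v₀)` is `v₀.adicCompletion ℚ` by `rfl`: read the FLT packet's algebra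
  -- structure on it (w2-acc5's theorems are typed over `Place.Completion`)
  letI instEF : Algebra (NumberField.Place.Completion (K := ℚ) (Sum.inr ((Rat.HeightOneSpectrum.primesEquiv (R := 𝓞 ℚ)).symm ⟨3, Fact.out⟩)))
      (w₀.1.adicCompletion (CyclotomicField (cycLevel 3 0 r) ℚ)) :=
    inferInstanceAs (Algebra (((Rat.HeightOneSpectrum.primesEquiv (R := 𝓞 ℚ)).symm ⟨3, Fact.out⟩).adicCompletion ℚ) (w₀.1.adicCompletion (CyclotomicField (cycLevel 3 0 r) ℚ)))
  -- the `w`-component of `Λ_{0,r}` READ BACK IN `L_{w₀}` (`(g̃_w)_* ∘ eval_w ∘ Ψ ∘ Λ`), and `e₃ ∘ φ` in `L_{w₀}`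
  let LF : H1 (tateRep W 3) (cycSubgroup 3 0 r) →+ w₀.1.adicCompletion (CyclotomicField (cycLevel 3 0 r) ℚ) :=
    (galAdicCompletionMap (sigma (cycLevel 3 0 r) (modNCyclotomicCharacter ℚ (cycLevel 3 0 r) (g w))) (hg w)).toAddMonoidHom.comp
      ((Pi.evalAddMonoidHom (fun w : ((Rat.HeightOneSpectrum.primesEquiv (R := 𝓞 ℚ)).symm ⟨3, Fact.out⟩).Extension
        (𝓞 (CyclotomicField (cycLevel 3 0 r) ℚ)) => w.1.adicCompletion (CyclotomicField (cycLevel 3 0 r) ℚ)) w).comp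
      (Ψ.toAddEquiv.toAddMonoidHom.comp (Λ 0 r).toAddMonoidHom))
  let e : (tateLocalRep W 3 (Sum.inr ((Rat.HeightOneSpectrum.primesEquiv (R := 𝓞 ℚ)).symm ⟨3, Fact.out⟩))).cohomology 1 →+ w₀.1.adicCompletion (CyclotomicField (cycLevel 3 0 r) ℚ) :=
    ((algebraMap (((Rat.HeightOneSpectrum.primesEquiv (R := 𝓞 ℚ)).symm ⟨3, Fact.out⟩).adicCompletion ℚ) (w₀.1.adicCompletion (CyclotomicField (cycLevel 3 0 r) ℚ))).toAddMonoidHom.comp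
      ((Padic.adicCompletionEquiv (𝓞 ℚ) ⟨3, Fact.out⟩).toRingEquiv.toAddMonoidHom)).comp φ
  have hLF : ∀ y, LF y = galAdicCompletionMap
      (sigma (cycLevel 3 0 r) (modNCyclotomicCharacter ℚ (cycLevel 3 0 r) (g w))) (hg w) (Ψ (Λ 0 r y) w) :=
    fun y => rfl
  have he : ∀ h, e h = algebraMap (((Rat.HeightOneSpectrum.primesEquiv (R := 𝓞 ℚ)).symm ⟨3, Fact.out⟩).adicCompletion ℚ) (w₀.1.adicCompletion (CyclotomicField (cycLevel 3 0 r) ℚ))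
      (Padic.adicCompletionEquiv (𝓞 ℚ) ⟨3, Fact.out⟩ (φ h)) := fun h => rfl
  -- w2-acc5's per-factor Galois side for the twisted localisation `loc^{tower}_{w₀} ∘ conjMap (g w)` AT `w₀`
  obtain ⟨y', hy'⟩ := exists_sub_eq_zsmul_apply_of_factorDef_conjMap W 3 j 0 r ((Rat.HeightOneSpectrum.primesEquiv (R := 𝓞 ℚ)).symm ⟨3, Fact.out⟩)
    (w₀.1.adicCompletion (CyclotomicField (cycLevel 3 0 r) ℚ)) (g w)
    (absGaloisRestrictTower_adicCompletion_mem_cycSubgroup r w₀) φ₀ LF e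
    (fun y φ'' hφ'' ψT hψT => by
      rw [hLF, hdef₀ w y φ'' ψT hφ'' hψT, galAdicCompletionMap_apply_inv]
      rfl)
    (fun h => by rw [he]; exact hres₀ h) Ψ' hΨ' y κ₀ h hres hlocκ
  refine ⟨S w (φ₀ y'), ⟨φ₀ y', hlat₀ y', rfl⟩, ?_⟩
  -- transport `e h − LF y = 3^{j+1} • φ₀ y'` along `S_w`: `S_w (e h) = e_w h`, `S_w (LF y) = Ψ(Λ y)_w`
  have hT := congrArg (S w) hy'
  rw [map_sub, map_zsmul, hLF, hS, hS, galAdicCompletionMap_inv_apply, he,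
    galAdicCompletionMap_algebraMap_adicCompletion] at hT
  -- bookkeeping: `Ψ(φ h ⊗ 1 − 3⁰•Λ y)_w = e_w h − Ψ(Λ y)_w = 3^{j+1} • S_w (φ₀ y')`
  rw [pow_zero, one_smul, map_sub, Pi.sub_apply, hΨ, map_one, one_mul, hT, zsmul_eq_mul, Int.cast_pow,
    Int.cast_natCast]
  rfl

end Summit.BirchSwinnertonDyer.BirchSwinnertonDyer.Theorems.KimAtThreeFineKatoTwoExpPerFactorSingle

end
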